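import Literature.Topology.FourManifolds.CorkDecomposition
import Literature.Topology.FourManifolds.BoundaryConnectedSum
import Literature.Topology.FourManifolds.ConnectedSumData
import HarnessLib

/-!
# Matveyev's cork decomposition: part 2 from part 1 and the "Fact" (the splitting rung)

This file proves the DAG edge just below `Literature.Topology.FourManifolds.Matveyev1996_decomposition`
(`Literature/Topology/FourManifolds/CorkDecomposition.lean`, §2) in the decomposition of the
cork theorem `Literature.Topology.FourManifolds.corkDecomposition` (`CorkTwist.lean`; Matveyev, *A decomposition of smooth
simply-connected h-cobordant 4-manifolds*, J. Differential Geom. 44 (1996), 571–582,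
arXiv:dg-ga/9505001): **part 2 of Matveyev's Theorem (`W₁ ≅ W₂`) follows from part 1 together with
the "Fact" of its proof** (`Literature.Topology.FourManifolds.Matveyev1996_partOne_and_fact`, `CorkDecomposition.lean` §4:
`W₁ ∪_Σ W₁ ≅ S⁴ ≅ W₁ ∪_Σ W₂`) by Matveyev's connected-sum manipulation (p. 3 and fig. 2):

  `M₁ ≅ M₁ # S⁴ = (W₁ ∪_Σ M) # (W₂ ∪_Σ W₁) ≅ (W₁ ♮ W₂) ∪_{Σ # Σ} (M ♮ W₁)`,
  `M₂ ≅ M₂ # S⁴ = (W₂ ∪_Σ M) # (W₁ ∪_Σ W₁) ≅ (W₂ ♮ W₁) ∪_{Σ # Σ} (M ♮ W₁)`,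

so that both `M₁` and `M₂` are the union of the *same* exterior `M' = M ♮ W₁` with the boundary
connected sums `W₁ ♮ W₂ = W₂ ♮ W₁` (compact and contractible), glued along `Σ # Σ`.

## Main statements

Proved:
* `Literature.Topology.FourManifolds.Matveyev1996_decomposition_of_partOne_and_fact`: the implication
  `Matveyev1996_partOne_and_fact ⟹ Matveyev1996_decomposition`, from the three named facts of this
  file and the three facts of `BoundaryConnectedSum.lean` (existence, compactness and
  contractibility of boundary connected sums), by the chain displayed above. The formal argument
  makes two points of the printed one explicit. (i) *Chirality.* All boundary connected sums are
  taken along one half-disc `k₁` in `W₁`, one `k_M` in `M` and one `k₂` in `W₂`, with flat faces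
  matched by the boundary identifications `φ₁ : ∂W₁ ≅ ∂M`, `ψ = φ₂⁻¹ ∘ φ₁ : ∂W₁ ≅ ∂W₂`; the
  exterior `M' = M ♮ W₁` (along `k_M`, `k₁`) is then literally the same manifold in both lines,
  and the new cork `W₁ ♮ W₂` (along `k₁`, `k₂`) *is* `W₂ ♮ W₁` (`Literature.Topology.FourManifolds.boundaryConnectedSumRel_swap`),
  so that "`W₁' ≅ W₂'`" is the identity. (ii) *`X # S⁴ ≅ X`* is used in the form "any connected
  sum of `X` with the standard sphere is diffeomorphic to `X`"
  (`Literature.Topology.FourManifolds.nonempty_diffeomorph_of_isConnectedSum_sphere`).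
* `Literature.Topology.FourManifolds.IsClosedGluing.diffeomorph_comp`, `Literature.Topology.FourManifolds.IsBoundaryGluing.diffeomorph_comp`: a gluing
  `P = M ∪_φ N` transported along a diffeomorphism `P ≅ P'` (post-composition of the piece
  embeddings, `Manifold.IsSmoothEmbedding.diffeomorph_comp`).
* `Literature.Topology.FourManifolds.EuclideanHalfSpace.face` (the flat face `ℝⁿ × {0} ↪ ℝⁿ⁺¹₊` of the closed half space) and
  its elementary API; `Literature.Topology.FourManifolds.BoundaryData.nonempty_carrier_of_isDouble_sphere` (a compact nonempty
  manifold whose double is a sphere has nonempty boundary).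

Named facts (statements only, D-0014):
* `Literature.Topology.FourManifolds.exists_halfDisc_face_eq`: a boundary datum `∂A` of a smooth manifold with boundary `A`
  (dimension `≥ 2`) and a disc `f : ℝⁿ⁺¹ ↪ ∂A` (smooth embedding with open range) admit a
  half-disc `k : ℝⁿ⁺²₊ ↪ A` (smooth embedding of the closed half space with open range) with flat
  face `k (0, x') = f x'` — from a collar of `∂A` (Hirsch, *Differential Topology*, Thm. 4.6.1).
* `Literature.Topology.FourManifolds.exists_isConnectedSum_isBoundaryGluing_of_halfDiscs`: **Matveyev's fig. 2** — the
  connected sum of two glued manifolds `X = A ∪_φ B`, `S = C ∪_χ D`, taken at points of the seams,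
  splits along `∂A # ∂C ≅ ∂B # ∂D` into the boundary connected sums `A ♮ C` and `B ♮ D`: for
  half-discs `k_A, k_B, k_C, k_D` whose flat faces correspond under `φ` and `χ`, and any models
  `P_AC`, `P_BD` of `A ♮ C`, `B ♮ D` along them, some connected sum `Q` of `X` and `S` is a gluing
  `P_AC ∪_θ P_BD` along the boundary.
* `Literature.Topology.FourManifolds.nonempty_diffeomorph_of_isConnectedSum_sphere`: `X # Sⁿ ≅ X` for every connected sum with
  the standard sphere (Kervaire–Milnor 1963, Lemma 2.1 and "`Sⁿ` serves as identity element";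
  Kosinski, *Differential Manifolds*, VI.1), via Palais' disc theorem in `Sⁿ`.

## Position in the DAG of `corkDecomposition`

`corkDecomposition ⟸ Matveyev1996_decomposition` (proved, `CorkDecomposition.lean` §3)
`⟸ Matveyev1996_partOne_and_fact ∧` (facts of this file and of `BoundaryConnectedSum.lean`)
(proved here). Below `Matveyev1996_partOne_and_fact` lie the h-cobordism rungs
(`HCobordismHandles.lean`, `HCobordismMiddleLevel.lean`) and the middle-level surgery /
Kirby-calculus arguments of Matveyev pp. 2–4, which are not yet statable in the tree.

## References

* R. Matveyev, *A decomposition of smooth simply-connected h-cobordant 4-manifolds*,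
  J. Differential Geom. 44 (1996), 571–582; arXiv:dg-ga/9505001 (Theorem; proof of part 2, arXiv p. 3,
  fig. 2; JDG pp. 573–574).
* A. Juhász, *Differential and Low-Dimensional Topology*, LMS Student Texts 104 (2023), Def. 1.44,
  Def. 1.47.
* M. Kervaire, J. Milnor, *Groups of homotopy spheres I*, Ann. of Math. 77 (1963), §2, Lemma 2.1.
* A. Kosinski, *Differential Manifolds* (1993), VI.1.
* R. Palais, *Extending diffeomorphisms*, Proc. AMS 11 (1960), Thm. B; J. Cerf (1961).
* M. Hirsch, *Differential Topology*, GTM 33 (1976), Thm. 4.6.1 (collars), §8.2 (gluing).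
-/

open scoped Manifold ContDiff Topology
open Set Function

noncomputable section

namespace Literature.Topology.FourManifolds

universe u v

/-- Local notation: `𝔼 n` is the model Euclidean space `EuclideanSpace ℝ (Fin n)`. -/
local notation "𝔼 " n:arg => EuclideanSpace ℝ (Fin n)

/-- Local notation: `𝕊 n` is the unit sphere in `EuclideanSpace ℝ (Fin (n + 1))`, the standard
`n`-sphere with its Mathlib smooth manifold structure. -/
local notation "𝕊 " n:arg => (Metric.sphere (0 : EuclideanSpace ℝ (Fin (n + 1))) 1)

/-! ### §0 The flat face of the closed half space -/

section Face

variable {n : ℕ}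

/-- **The flat face of the closed half space**: the inclusion `x' ↦ (0, x')` of `ℝⁿ` onto the
boundary hyperplane `{x 0 = 0}` of `EuclideanHalfSpace (n + 1) = {x : ℝⁿ⁺¹ | 0 ≤ x 0}` — the face
`D = Dⁿ⁻¹ ⊂ H` along which a half-disc `(H, D) ↪ (X, ∂X)` meets the boundary in Juhász's
definition of the boundary connected sum. [cite: Juhasz2023, Def. 1.47] -/
def EuclideanHalfSpace.face (x' : 𝔼 n) : EuclideanHalfSpace (n + 1) :=
  ⟨WithLp.toLp 2 (Fin.cons (0 : ℝ) (WithLp.ofLp x')), by simp⟩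

/-- The `0`-th coordinate (height above the flat face) of a face point vanishes. [cite: Juhasz2023, Def. 1.47] -/
@[simp] theorem EuclideanHalfSpace.val_face_apply_zero (x' : 𝔼 n) :
    (EuclideanHalfSpace.face x').val 0 = 0 := by
  simp [EuclideanHalfSpace.face]

/-- The remaining coordinates of the face point `face x'` are those of `x'`. [cite: Juhasz2023, Def. 1.47] -/
@[simp] theorem EuclideanHalfSpace.val_face_apply_succ (x' : 𝔼 n) (i : Fin n) :
    (EuclideanHalfSpace.face x').val i.succ = x' i := by
  simp [EuclideanHalfSpace.face]

/-- The face inclusion is injective. [cite: Juhasz2023, Def. 1.47] -/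
theorem EuclideanHalfSpace.face_injective : Injective (EuclideanHalfSpace.face (n := n)) := by
  intro x y h
  have h' := congrArg (fun z : EuclideanHalfSpace (n + 1) => fun i : Fin n => z.val i.succ) h
  ext i
  simpa using congrFun h' i

/-- The face inclusion sends the origin to the origin (the centre of the half-discs). [cite: Juhasz2023, Def. 1.47] -/
@[simp] theorem EuclideanHalfSpace.face_zero : EuclideanHalfSpace.face (0 : 𝔼 n) = 0 := by
  apply Subtype.ext
  change WithLp.toLp 2 (Fin.cons (0 : ℝ) (WithLp.ofLp (0 : 𝔼 n))) = (0 : 𝔼 (n + 1))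
  ext i
  refine Fin.cases ?_ (fun j => ?_) i <;> simp

/-- The face inclusion preserves the Euclidean norm; in particular it maps the unit vectors of
`ℝⁿ` to unit vectors of the closed half space lying on the flat face. [cite: Juhasz2023, Def. 1.47] -/
theorem EuclideanHalfSpace.norm_val_face (x' : 𝔼 n) :
    ‖(EuclideanHalfSpace.face x').val‖ = ‖x'‖ := by
  simp only [EuclideanHalfSpace.face, EuclideanSpace.norm_eq]
  rw [Fin.sum_univ_succ]
  simp

/-- The face inclusion is continuous. [cite: Juhasz2023, Def. 1.47] -/
theorem EuclideanHalfSpace.continuous_face : Continuous (EuclideanHalfSpace.face (n := n)) := by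
  apply Continuous.subtype_mk
  refine (PiLp.continuous_toLp 2 _).comp ?_
  exact continuous_const.finCons (PiLp.continuous_ofLp 2 _)

end Face

/-! ### §1 Transporting a closed gluing along a diffeomorphism of the glued manifold -/

section Transport

variable {EA HA EB HB EP HP : Type*}
  [NormedAddCommGroup EA] [NormedSpace ℝ EA] [TopologicalSpace HA] {IA : ModelWithCorners ℝ EA HA}
  [NormedAddCommGroup EB] [NormedSpace ℝ EB] [TopologicalSpace HB] {IB : ModelWithCorners ℝ EB HB}
  [NormedAddCommGroup EP] [NormedSpace ℝ EP] [TopologicalSpace HP] {IP : ModelWithCorners ℝ EP HP}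
  {A B : Type*} [TopologicalSpace A] [ChartedSpace HA A] [TopologicalSpace B] [ChartedSpace HB B]
  {P P' : Type*} [TopologicalSpace P] [ChartedSpace HP P] [TopologicalSpace P'] [ChartedSpace HP P']

/-- **A closed gluing transported along a diffeomorphism of the glued manifold**: if `P` is the
closed gluing of `A` and `B` along `R` and `e : P ≅ P'` is a diffeomorphism (same model), then so
is `P'` — post-compose the piece embeddings with `e` (a smooth embedding followed by a
diffeomorphism is a smooth embedding, `Manifold.IsSmoothEmbedding.diffeomorph_comp`). The
`IsManifold` hypotheses are needed because smooth embeddings refer to the maximal atlases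
(cf. `Literature.Topology.FourManifolds.IsOpenGluing.of_diffeomorph`). Hirsch, *Differential Topology* (1976), §8.2. [folklore] -/
theorem IsClosedGluing.diffeomorph_comp [IsManifold IP ∞ P] [IsManifold IP ∞ P']
    {R : A → B → Prop} (h : IsClosedGluing IA IB IP (P := P) R) (e : P ≃ₘ⟮IP, IP⟯ P') :
    IsClosedGluing IA IB IP (P := P') R := by
  obtain ⟨jA, jB, hA, hB, hU, hR⟩ := h
  have hs : Surjective (⇑e) := e.surjective
  have hi : Injective (⇑e) := e.injective
  refine ⟨e ∘ jA, e ∘ jB, hA.diffeomorph_comp e, hB.diffeomorph_comp e, ?_, fun a b => ?_⟩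
  · rw [range_comp, range_comp, ← image_union, hU, image_univ, hs.range_eq]
  · rw [comp_apply, comp_apply, hi.eq_iff, hR a b]

variable {E₀ H₀ E₀' H₀' : Type*} [NormedAddCommGroup E₀] [NormedSpace ℝ E₀] [TopologicalSpace H₀]
  {I₀ : ModelWithCorners ℝ E₀ H₀} [NormedAddCommGroup E₀'] [NormedSpace ℝ E₀']
  [TopologicalSpace H₀'] {I₀' : ModelWithCorners ℝ E₀' H₀'}
  {M N : Type u} [TopologicalSpace M] [ChartedSpace HA M] [TopologicalSpace N] [ChartedSpace HB N]
  {bM : BoundaryData IA M I₀} {bN : BoundaryData IB N I₀'}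

/-- **A gluing along the boundary transported along a diffeomorphism of the glued manifold**:
if `P = M ∪_φ N` and `e : P ≅ P'` then `P' = M ∪_φ N` (Hirsch, *Differential Topology* (1976),
§8.2: the glued manifold is well defined up to diffeomorphism, and conversely anything
diffeomorphic to a gluing is one). [folklore] -/
theorem IsBoundaryGluing.diffeomorph_comp [IsManifold IP ∞ P] [IsManifold IP ∞ P']
    {φ : bM.carrier → bN.carrier} (h : IsBoundaryGluing bM bN φ IP P) (e : P ≃ₘ⟮IP, IP⟯ P') :
    IsBoundaryGluing bM bN φ IP P' :=
  IsClosedGluing.diffeomorph_comp h e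

end Transport

/-! ### §2 Three named facts (D-0014) -/

section Facts

/-- **Half-discs with prescribed flat face.** Let `A` be a smooth manifold with boundary of
dimension `n + 2 ≥ 2` (Hausdorff, second countable, modelled on `𝓡∂ (n + 2)`), `b` a boundary
datum of `A` (`∂A` as a smooth `(n+1)`-manifold with its embedding `b.incl`), and
`f : ℝⁿ⁺¹ → ∂A` a smooth embedding with open range (a "disc" of `∂A`). Then there is a smooth
embedding `k : EuclideanHalfSpace (n + 2) → A` of the closed half space with open range — a
half-disc `(H, D) ↪ (A, ∂A)` in the sense of `Literature.Topology.FourManifolds.IsBoundaryConnectedSum` — whose flat face is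
`f`: `k (0, x') = b.incl (f x')`. Proof in print: compose a collar `c : ∂A × [0, 1) ↪ A` of the
boundary (Hirsch, *Differential Topology* (1976), Thm. 4.6.1; the tree's
`Literature.Topology.FourManifolds.BoundaryData.nonempty_collar`, stated in dimension `≥ 2` for the same reason as here) with
`(x₀, x') ↦ (f x', σ x₀)` for a diffeomorphism `σ : [0, ∞) ≅ [0, 1/2)`. Absent from Mathlib (no
collars). [cite: Hirsch1976, Thm. 4.6.1 (collaring theorem)] -/
def exists_halfDisc_face_eq : Prop :=
  ∀ (n : ℕ) (A : Type u) [TopologicalSpace A] [T2Space A] [SecondCountableTopology A]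
    [ChartedSpace (EuclideanHalfSpace (n + 2)) A] [IsManifold (𝓡∂ (n + 2)) ∞ A]
    (b : BoundaryData (𝓡∂ (n + 2)) A (𝓡 (n + 1))) (f : 𝔼 (n + 1) → b.carrier),
    Manifold.IsSmoothEmbedding (𝓡 (n + 1)) (𝓡 (n + 1)) ∞ f → IsOpen (range f) →
      ∃ k : EuclideanHalfSpace (n + 2) → A,
        Manifold.IsSmoothEmbedding (𝓡∂ (n + 2)) (𝓡∂ (n + 2)) ∞ k ∧ IsOpen (range k) ∧
        ∀ x', k (EuclideanHalfSpace.face x') = b.incl (f x')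

/-- **Matveyev's fig. 2: a connected sum of two glued manifolds, taken on the seams, splits into
boundary connected sums.** Let `X = A ∪_φ B` and `S = C ∪_χ D` be smooth `(n+2)`-manifolds glued
from compact smooth manifolds with boundary along diffeomorphisms `φ : ∂A ≅ ∂B`, `χ : ∂C ≅ ∂D`
(`Literature.Topology.FourManifolds.IsBoundaryGluing`). Let `k_A, k_B, k_C, k_D` be half-discs (smooth embeddings of the closed
half space with open range) in `A, B, C, D` whose flat faces correspond under the gluing maps:
`k_A (0, x') = f_A x'`, `k_B (0, x') = φ (f_A x')`, `k_C (0, x') = f_C x'`, `k_D (0, x') = χ (f_C x')`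
(so that `k_A ∪ k_B` and `k_C ∪ k_D` are balls in `X` and `S` centred on the seams and cut by them
into halves), and let `P_AC`, `P_BD` be boundary connected sums `A ♮ C`, `B ♮ D` along these
half-discs (open gluings along `Literature.Topology.FourManifolds.boundaryConnectedSumRel`, Juhász Def. 1.47). Then some
connected sum `Q = X # S` (Kervaire–Milnor's relation along the balls `k_A ∪ k_B`, `k_C ∪ k_D`,
after adapting the piece embeddings near the seams by uniqueness of collars) is the gluing
`P_AC ∪_θ P_BD` of `A ♮ C` and `B ♮ D` along a diffeomorphism `θ : ∂(A ♮ C) ≅ ∂(B ♮ D)` (namely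
`φ # χ : ∂A # ∂C ≅ ∂B # ∂D`), for suitable boundary data. This is the identity
`(M ♯_Σ W₁) # (W₁ ♯_Σ W₂) ≅ (M ♮ W₁) ♯_{Σ # Σ} (W₁ ♮ W₂)` of Matveyev's proof of part 2 of his
Theorem (p. 3, fig. 2), stated for general pieces and dimension `n + 2 ≥ 2` (collars, used in the
proof, need dimension `≥ 2` in the tree: `Literature.Topology.FourManifolds.BoundaryData.nonempty_collar`); connected sums and
boundary connected sums are in the relational forms `Literature.Topology.FourManifolds.IsConnectedSum`, `Literature.IsOpenGluing … 
(boundaryConnectedSumRel …)` of the tree, and `X`, `S` may live in different universes (in the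
application `S` is the concrete sphere `𝕊⁴`).
[cite: Matveyev1996, proof of Theorem part 2, fig. 2 (arXiv p. 3)] -/
def exists_isConnectedSum_isBoundaryGluing_of_halfDiscs : Prop :=
  ∀ (n : ℕ) (A B C D PAC PBD X : Type u) (S : Type v)
    [TopologicalSpace A] [T2Space A] [SecondCountableTopology A]
    [ChartedSpace (EuclideanHalfSpace (n + 2)) A] [IsManifold (𝓡∂ (n + 2)) ∞ A] [CompactSpace A]
    [TopologicalSpace B] [T2Space B] [SecondCountableTopology B]
    [ChartedSpace (EuclideanHalfSpace (n + 2)) B] [IsManifold (𝓡∂ (n + 2)) ∞ B] [CompactSpace B]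
    [TopologicalSpace C] [T2Space C] [SecondCountableTopology C]
    [ChartedSpace (EuclideanHalfSpace (n + 2)) C] [IsManifold (𝓡∂ (n + 2)) ∞ C] [CompactSpace C]
    [TopologicalSpace D] [T2Space D] [SecondCountableTopology D]
    [ChartedSpace (EuclideanHalfSpace (n + 2)) D] [IsManifold (𝓡∂ (n + 2)) ∞ D] [CompactSpace D]
    [TopologicalSpace PAC] [T2Space PAC] [SecondCountableTopology PAC]
    [ChartedSpace (EuclideanHalfSpace (n + 2)) PAC] [IsManifold (𝓡∂ (n + 2)) ∞ PAC]
    [TopologicalSpace PBD] [T2Space PBD] [SecondCountableTopology PBD]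
    [ChartedSpace (EuclideanHalfSpace (n + 2)) PBD] [IsManifold (𝓡∂ (n + 2)) ∞ PBD]
    [TopologicalSpace X] [T2Space X] [SecondCountableTopology X] [ChartedSpace (𝔼 (n + 2)) X]
    [IsManifold (𝓡 (n + 2)) ∞ X]
    [TopologicalSpace S] [T2Space S] [SecondCountableTopology S] [ChartedSpace (𝔼 (n + 2)) S]
    [IsManifold (𝓡 (n + 2)) ∞ S]
    (bA : BoundaryData (𝓡∂ (n + 2)) A (𝓡 (n + 1))) (bB : BoundaryData (𝓡∂ (n + 2)) B (𝓡 (n + 1)))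
    (bC : BoundaryData (𝓡∂ (n + 2)) C (𝓡 (n + 1))) (bD : BoundaryData (𝓡∂ (n + 2)) D (𝓡 (n + 1)))
    (φ : bA.carrier ≃ₘ⟮𝓡 (n + 1), 𝓡 (n + 1)⟯ bB.carrier)
    (χ : bC.carrier ≃ₘ⟮𝓡 (n + 1), 𝓡 (n + 1)⟯ bD.carrier)
    (kA : EuclideanHalfSpace (n + 2) → A) (kB : EuclideanHalfSpace (n + 2) → B)
    (kC : EuclideanHalfSpace (n + 2) → C) (kD : EuclideanHalfSpace (n + 2) → D)
    (fA : 𝔼 (n + 1) → bA.carrier) (fC : 𝔼 (n + 1) → bC.carrier),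
    IsBoundaryGluing bA bB φ (𝓡 (n + 2)) X → IsBoundaryGluing bC bD χ (𝓡 (n + 2)) S →
    Manifold.IsSmoothEmbedding (𝓡∂ (n + 2)) (𝓡∂ (n + 2)) ∞ kA → IsOpen (range kA) →
    Manifold.IsSmoothEmbedding (𝓡∂ (n + 2)) (𝓡∂ (n + 2)) ∞ kB → IsOpen (range kB) →
    Manifold.IsSmoothEmbedding (𝓡∂ (n + 2)) (𝓡∂ (n + 2)) ∞ kC → IsOpen (range kC) →
    Manifold.IsSmoothEmbedding (𝓡∂ (n + 2)) (𝓡∂ (n + 2)) ∞ kD → IsOpen (range kD) →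
    (∀ x', kA (EuclideanHalfSpace.face x') = bA.incl (fA x')) →
    (∀ x', kB (EuclideanHalfSpace.face x') = bB.incl (φ (fA x'))) →
    (∀ x', kC (EuclideanHalfSpace.face x') = bC.incl (fC x')) →
    (∀ x', kD (EuclideanHalfSpace.face x') = bD.incl (χ (fC x'))) →
    IsOpenGluing (𝓡∂ (n + 2)) (𝓡∂ (n + 2)) (𝓡∂ (n + 2)) (A := puncture kA) (B := puncture kC)
      (P := PAC) (boundaryConnectedSumRel kA kC) →
    IsOpenGluing (𝓡∂ (n + 2)) (𝓡∂ (n + 2)) (𝓡∂ (n + 2)) (A := puncture kB) (B := puncture kD)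
      (P := PBD) (boundaryConnectedSumRel kB kD) →
      ∃ (Q : Type u) (_ : TopologicalSpace Q) (_ : T2Space Q) (_ : SecondCountableTopology Q)
        (_ : ChartedSpace (𝔼 (n + 2)) Q) (_ : IsManifold (𝓡 (n + 2)) ∞ Q)
        (β : BoundaryData (𝓡∂ (n + 2)) PAC (𝓡 (n + 1)))
        (β' : BoundaryData (𝓡∂ (n + 2)) PBD (𝓡 (n + 1)))
        (θ : β.carrier ≃ₘ⟮𝓡 (n + 1), 𝓡 (n + 1)⟯ β'.carrier),
        IsConnectedSum (𝓡 (n + 2)) (𝓡 (n + 2)) (𝓡 (n + 2)) X S Q ∧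
        IsBoundaryGluing β β' θ (𝓡 (n + 2)) Q

/-- **`X # Sⁿ ≅ X` for every connected sum with the standard sphere.** If the smooth
`n`-manifold `Q` is a connected sum (`Literature.Topology.FourManifolds.IsConnectedSum`, Kervaire–Milnor's relation along
arbitrary discs `i₁ : ℝⁿ ↪ X`, `i₂ : ℝⁿ ↪ Sⁿ`) of the smooth `n`-manifold `X` and the standard
sphere `Sⁿ`, then `Q ≅ X`. Kervaire–Milnor, *Groups of homotopy spheres I* (1963), §2 ("`Sⁿ`
serves as identity element", with Lemma 2.1); Kosinski, *Differential Manifolds* (1993), VI.1.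
For arbitrary discs this uses Palais' disc theorem in `Sⁿ` (*Extending diffeomorphisms* (1960),
Thm. B; Cerf 1961: any smooth closed disc in `Sⁿ` is ambient isotopic to a round one, `Sⁿ` having
orientation-reversing symmetries), so that `Sⁿ ∖ i₂ (ball)` is a closed disc filling the hole of
`X ∖ i₁ (ball)` back in, together with uniqueness of open gluings (the tree's proved
`Literature.Topology.FourManifolds.IsOpenGluing.nonempty_diffeomorph`). No connectedness or orientation hypothesis on `X` is
needed. The tree's `Literature.Topology.FourManifolds.isConnectedSum_sphere_self` is the existence counterpart (`X` *is* some
connected sum `X # Sⁿ`). [cite: KervaireMilnor1963, §2, Lemma 2.1 ("Sⁿ serves as identity element")] -/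
def nonempty_diffeomorph_of_isConnectedSum_sphere : Prop :=
  ∀ (n : ℕ) (X Q : Type u) [TopologicalSpace X] [T2Space X] [SecondCountableTopology X]
    [ChartedSpace (𝔼 n) X] [IsManifold (𝓡 n) ∞ X]
    [TopologicalSpace Q] [T2Space Q] [SecondCountableTopology Q] [ChartedSpace (𝔼 n) Q]
    [IsManifold (𝓡 n) ∞ Q],
    IsConnectedSum (𝓡 n) (𝓡 n) (𝓡 n) X (𝕊 n) Q → Nonempty (Q ≃ₘ⟮𝓡 n, 𝓡 n⟯ X)

end Facts

/-! ### §3 A lemma on the data of `Matveyev1996_partOne_and_fact`: `∂W₁ ≠ ∅` -/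

section Lemmas

variable {n : ℕ} {W : Type u} [TopologicalSpace W] [ChartedSpace (EuclideanHalfSpace (n + 1)) W]

/-- If the standard sphere `𝕊ᵐ⁺¹` is the double `W ∪_{id} W` of a compact `W`, then `∂W ≠ ∅`:
otherwise the two copies of `W` (nonempty, as they cover the sphere) would be disjoint nonempty
closed sets covering the connected space `𝕊ᵐ⁺¹`. (Used for Matveyev's `W₁`, whose double is `S⁴` by the "Fact".) [folklore] -/
theorem BoundaryData.nonempty_carrier_of_isDouble_sphere {m : ℕ} [CompactSpace W]
    {b : BoundaryData (𝓡∂ (n + 1)) W (𝓡 n)} (h : IsDouble b (𝓡 (m + 1)) (𝕊 (m + 1))) :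
    Nonempty b.carrier := by
  by_contra hemp
  rw [not_nonempty_iff] at hemp
  obtain ⟨t, t', ht, ht', hU, hR⟩ := h
  -- `W` is nonempty: the sphere is, and it is covered by the two copies of `W`
  have hW : Nonempty W := by
    have hp : (⟨EuclideanSpace.single 0 1, by simp⟩ : 𝕊 (m + 1)) ∈ range t ∪ range t' := by
      rw [hU]; exact mem_univ _
    rcases hp with ⟨w, -⟩ | ⟨w, -⟩ <;> exact ⟨w⟩
  have hdisj : Disjoint (range t) (range t') := by
    rw [disjoint_iff_forall_ne]
    rintro _ ⟨a, rfl⟩ _ ⟨a', rfl⟩ h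
    obtain ⟨z, -, -⟩ := (hR a a').1 h
    exact hemp.elim z
  have hc : IsClosed (range t) := (isCompact_range ht.isEmbedding.continuous).isClosed
  have hc' : IsClosed (range t') := (isCompact_range ht'.isEmbedding.continuous).isClosed
  have hcompl : (range t')ᶜ = range t := by
    refine Subset.antisymm (fun p hp => ?_) fun p hp hp' => hdisj.ne_of_mem hp hp' rfl
    rcases (hU.symm ▸ mem_univ p : p ∈ range t ∪ range t') with h | h
    · exact h
    · exact (hp h).elim
  have hclopen : IsClopen (range t) := ⟨hc, hcompl ▸ hc'.isOpen_compl⟩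
  haveI : PreconnectedSpace (𝕊 (m + 1)) := by
    refine isPreconnected_iff_preconnectedSpace.mp (isPreconnected_sphere ?_ 0 1)
    rw [← Module.finrank_eq_rank, finrank_euclideanSpace_fin]
    exact_mod_cast (by omega : 1 < m + 1 + 1)
  rcases isClopen_iff.1 hclopen with h0 | h1
  · obtain ⟨w⟩ := hW
    exact (h0.subset (mem_range_self (f := t) w)).elim
  · obtain ⟨w⟩ := hW
    have : t' w ∈ (range t')ᶜ := by rw [hcompl, h1]; exact mem_univ _
    exact this (mem_range_self w)

end Lemmas

/-! ### §4 Part 2 of Matveyev's Theorem from part 1 and the Fact -/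

section Assembly

/-- **Matveyev's Theorem, part 2 from part 1 and the "Fact"** (Matveyev 1996, proof of part 2,
p. 3 and fig. 2). Assume the bundled node `Matveyev1996_partOne_and_fact` (decompositions
`X₁ = W₁ ∪_{φ₁} M`, `X₂ = W₂ ∪_{φ₂} M` with `S⁴ = W₁ ∪_{id} W₁ = W₁ ∪_ψ W₂`, `ψ = φ₂⁻¹ ∘ φ₁`), the
three named facts of this file and the three facts of `BoundaryConnectedSum.lean`. Then
`Matveyev1996_decomposition` holds, with new corks `W₁' = W₂' = W₁ ♮ W₂` and new exterior
`M' = M ♮ W₁`. Proof (formalising Matveyev's chain, see the module docstring): choose a disc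
`f : ℝ³ ↪ ∂W₁` (a chart of `∂W₁ ≠ ∅` onto `ℝ³`) and half-discs `k₁ ⊂ W₁`, `k_M ⊂ M`, `k₂ ⊂ W₂`
with faces `f`, `φ₁ ∘ f`, `ψ ∘ f`; let `W' = W₁ ♮ W₂` (along `k₁, k₂`; compact, contractible) and
`M' = M ♮ W₁` (along `k_M, k₁`; compact). By the splitting fact applied to
`X₁ # S⁴ = (W₁ ∪_{φ₁} M) # (W₂ ∪_{ψ⁻¹} W₁)` and to `X₂ # S⁴ = (W₂ ∪_{φ₂} M) # (W₁ ∪_{id} W₁)`, some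
connected sums `Q₁ = X₁ # S⁴`, `Q₂ = X₂ # S⁴` are gluings `W' ∪ M'` along the boundary; by
`X # S⁴ ≅ X` and transport (`IsBoundaryGluing.diffeomorph_comp`) so are `X₁` and `X₂`; finally
the boundary data of the second gluing are re-indexed to those of the first
(`IsBoundaryGluing.transfer` along identity diffeomorphisms), and `W₁' ≅ W₂'` is the identity.
[cite: Matveyev1996, Theorem part 2, proof and fig. 2 (arXiv p. 3)] -/
theorem Matveyev1996_decomposition_of_partOne_and_fact
    (hB : Matveyev1996_partOne_and_fact.{u})
    (hR0 : exists_halfDisc_face_eq.{u})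
    (hS : exists_isConnectedSum_isBoundaryGluing_of_halfDiscs.{u, 0})
    (hU : nonempty_diffeomorph_of_isConnectedSum_sphere.{u})
    (hE : exists_isOpenGluing_boundaryConnectedSumRel.{u})
    (hc : compactSpace_of_isOpenGluing_boundaryConnectedSumRel.{u})
    (hk : contractibleSpace_of_isOpenGluing_boundaryConnectedSumRel.{u}) :
    Matveyev1996_decomposition.{u} := by
  intro X₁ X₂ _ _ _ _ _ _ _ _ _ _ _ _ _ _ hcob
  obtain ⟨W₁, W₂, M, _, _, _, _, _, _, _, _, _, _, _, _, _, _, _, b₁, b₂, bM, φ₁, φ₂, hc₁, hk₁, hc₂,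
    hk₂, hcM, hX₁, hX₂, hSa, hSb⟩ := hB X₁ X₂ hcob
  haveI : CompactSpace W₁ := hc₁
  haveI : CompactSpace W₂ := hc₂
  haveI : CompactSpace M := hcM
  haveI : ContractibleSpace W₁ := hk₁
  haveI : ContractibleSpace W₂ := hk₂
  -- `∂W₁ ≠ ∅` since the double of `W₁` is the connected `S⁴`
  have hne : Nonempty b₁.carrier := BoundaryData.nonempty_carrier_of_isDouble_sphere hSa
  -- a disc `f : ℝ³ ↪ ∂W₁`: the inverse of a chart of `∂W₁` onto `ℝ³`
  obtain ⟨z₀⟩ := hne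
  obtain ⟨c, hcatlas, -, hct, -⟩ :=
    exists_mem_maximalAtlas_target_eq_univ (E := 𝔼 3) (M := b₁.carrier) z₀
  have hf : Manifold.IsSmoothEmbedding (𝓡 3) (𝓡 3) ∞ (⇑c.symm : 𝔼 3 → b₁.carrier) :=
    isSmoothEmbedding_symm_of_target_eq_univ hcatlas hct
  have hfo : IsOpen (range (⇑c.symm : 𝔼 3 → b₁.carrier)) := by
    have : range (⇑c.symm : 𝔼 3 → b₁.carrier) = c.source := by
      rw [← image_univ, ← hct, c.symm_image_target_eq_source]
    rw [this]
    exact c.open_source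
  set f : 𝔼 3 → b₁.carrier := ⇑c.symm with hf_def
  set ψ : b₁.carrier ≃ₘ⟮𝓡 3, 𝓡 3⟯ b₂.carrier := φ₁.trans φ₂.symm with hψ
  have hfφ : Manifold.IsSmoothEmbedding (𝓡 3) (𝓡 3) ∞ (φ₁ ∘ f) := hf.diffeomorph_comp φ₁
  have hfφo : IsOpen (range (φ₁ ∘ f)) := by
    rw [range_comp]; exact φ₁.toHomeomorph.isOpenMap _ hfo
  have hfψ : Manifold.IsSmoothEmbedding (𝓡 3) (𝓡 3) ∞ (ψ ∘ f) := hf.diffeomorph_comp ψ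
  have hfψo : IsOpen (range (ψ ∘ f)) := by
    rw [range_comp]; exact ψ.toHomeomorph.isOpenMap _ hfo
  -- half-discs `k₁ ⊂ W₁`, `k_M ⊂ M`, `k₂ ⊂ W₂` with faces `f`, `φ₁ ∘ f`, `ψ ∘ f`
  obtain ⟨k₁, e₁, o₁, hface₁⟩ := hR0 2 W₁ b₁ f hf hfo
  obtain ⟨kM, eM, oM, hfaceM⟩ := hR0 2 M bM (φ₁ ∘ f) hfφ hfφo
  obtain ⟨k₂, e₂, o₂, hface₂⟩ := hR0 2 W₂ b₂ (ψ ∘ f) hfψ hfψo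
  -- the new cork `W' = W₁ ♮ W₂` and the new exterior `M' = M ♮ W₁`
  obtain ⟨W', _, _, _, _, _, hW'⟩ := hE _ W₁ W₂ k₁ k₂ e₁ o₁ e₂ o₂
  obtain ⟨M', _, _, _, _, _, hM'⟩ := hE _ M W₁ kM k₁ eM oM e₁ o₁
  haveI : CompactSpace W' := hc _ W₁ W₂ W' k₁ k₂ e₁ o₁ e₂ o₂ hW'
  haveI : CompactSpace M' := hc _ M W₁ M' kM k₁ eM oM e₁ o₁ hM'
  have hkW' : ContractibleSpace W' := hk _ W₁ W₂ W' k₁ k₂ hk₁ hk₂ e₁ o₁ e₂ o₂ hW'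
  have hW'symm : IsOpenGluing (𝓡∂ 4) (𝓡∂ 4) (𝓡∂ 4) (A := puncture k₂) (B := puncture k₁)
      (P := W') (boundaryConnectedSumRel k₂ k₁) := by
    rw [← boundaryConnectedSumRel_swap]
    exact hW'.symm
  -- chain 1: `X₁ # S⁴ = (W₁ ∪_{φ₁} M) # (W₂ ∪_{ψ⁻¹} W₁) = W' ∪ M'`
  have hSb' : IsBoundaryGluing b₂ b₁ ψ.symm (𝓡 4) (𝕊 4) := hSb.symm'
  have hfaceD₁ : ∀ x', k₁ (EuclideanHalfSpace.face x') = b₁.incl (ψ.symm ((ψ ∘ f) x')) :=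
    fun x' => by rw [hface₁]; simp
  obtain ⟨Q₁, _, _, _, _, _, β₁, β₁', θ₁, hcs₁, hg₁⟩ :=
    hS 2 W₁ M W₂ W₁ W' M' X₁ (𝕊 4) b₁ bM b₂ b₁ φ₁ ψ.symm k₁ kM k₂ k₁ f (ψ ∘ f) hX₁ hSb'
      e₁ o₁ eM oM e₂ o₂ e₁ o₁ hface₁ hfaceM hface₂ hfaceD₁ hW' hM'
  obtain ⟨eQ₁⟩ := hU _ X₁ Q₁ hcs₁
  have hg₁X : IsBoundaryGluing β₁ β₁' θ₁ (𝓡 4) X₁ := hg₁.diffeomorph_comp eQ₁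
  -- chain 2: `X₂ # S⁴ = (W₂ ∪_{φ₂} M) # (W₁ ∪_{id} W₁) = W' ∪ M'` (`W' = W₂ ♮ W₁` by symmetry)
  have hSa' : IsBoundaryGluing b₁ b₁ (Diffeomorph.refl (𝓡 3) b₁.carrier ∞) (𝓡 4) (𝕊 4) :=
    isBoundaryGluing_congr (fun z => by simp) hSa.isBoundaryGluing
  have hfaceM₂ : ∀ x', kM (EuclideanHalfSpace.face x') = bM.incl (φ₂ ((ψ ∘ f) x')) :=
    fun x' => by rw [hfaceM]; simp [hψ]
  have hfaceD₂ : ∀ x', k₁ (EuclideanHalfSpace.face x') =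
      b₁.incl ((Diffeomorph.refl (𝓡 3) b₁.carrier ∞) (f x')) :=
    fun x' => by rw [hface₁]; simp
  obtain ⟨Q₂, _, _, _, _, _, β₂, β₂', θ₂, hcs₂, hg₂⟩ :=
    hS 2 W₂ M W₁ W₁ W' M' X₂ (𝕊 4) b₂ bM b₁ b₁ φ₂ (Diffeomorph.refl (𝓡 3) b₁.carrier ∞)
      k₂ kM k₁ k₁ (ψ ∘ f) f hX₂ hSa' e₂ o₂ eM oM e₁ o₁ e₁ o₁ hface₂ hfaceM₂ hface₁ hfaceD₂
      hW'symm hM'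
  obtain ⟨eQ₂⟩ := hU _ X₂ Q₂ hcs₂
  have hg₂X : IsBoundaryGluing β₂ β₂' θ₂ (𝓡 4) X₂ := hg₂.diffeomorph_comp eQ₂
  -- re-index the second gluing to the boundary data `β₁`, `β₁'` of the first
  have h₁ : IsBoundaryGluing β₁ β₂'
      ((β₁.restrictDiffeomorph β₂ (Diffeomorph.refl (𝓡∂ 4) W' ∞)).trans θ₂) (𝓡 4) X₂ :=
    IsClosedGluing.congr (hg₂X.transfer (b₁ := β₁) (Diffeomorph.refl (𝓡∂ 4) W' ∞))
      fun a b => Iff.rfl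
  have h₂ : IsBoundaryGluing β₁' β₁ ((β₁'.restrictDiffeomorph β₂'
      (Diffeomorph.refl (𝓡∂ 4) M' ∞)).trans
        ((β₁.restrictDiffeomorph β₂ (Diffeomorph.refl (𝓡∂ 4) W' ∞)).trans θ₂).symm) (𝓡 4) X₂ :=
    IsClosedGluing.congr (h₁.symm'.transfer (b₁ := β₁') (Diffeomorph.refl (𝓡∂ 4) M' ∞))
      fun a b => Iff.rfl
  exact ⟨W', W', M', ‹_›, ‹_›, ‹_›, ‹_›, ‹_›, ‹_›, ‹_›, ‹_›, ‹_›, ‹_›, ‹_›, ‹_›, ‹_›, ‹_›, ‹_›,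
    β₁, β₁, β₁', θ₁, _, ‹_›, hkW', ‹_›, hkW', ‹_›, hg₁X, h₂.symm', ⟨Diffeomorph.refl (𝓡∂ 4) W' ∞⟩⟩

end Assembly

end Literature.Topology.FourManifolds

end
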